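import Mathlib
import Summits.KontsevichZagierPeriods.Zeta5Search.SorokinCensus.GeneralizedReversal
import Summits.KontsevichZagierPeriods.Zeta5Search.SorokinCensus.WellPoisedSevenOdd
import HarnessLib

/-!
# `RawLocusOdd` and BALANCED ⇒ ODD, closed modulo ONE cited identity (FAMILY 17d, inputs (I2)+(I3))

HONEST FRAMING (cell pub-zeta5): systematic search; no irrationality claim unless certified.

`Generalized*.lean` reduce BALANCED ⇒ ODD for the generalized Sorokin family (`BalancedOddIntegrable`) to the single
arithmetic input `RawLocusOdd`: every admissible integrable RAW point `q = (a₀; a | b)` of the very-well-poised locus `L₅`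
(`b₁+a₂ = ⋯ = b₄+a₅ =: S`, paper indices; `S = b 0 + a 1` in the 0-based fields) with `a₀ ≥ 1` has
`J₅(q) ∈ ℚ + ℚζ(3) + ℚζ(5)`.  THIS FILE proves that input — on the WHOLE convergence range, no residual — from ONE
published identity typed in `Literature/` as a named fact, all arithmetic being kernel-proved:

* `Zudilin2002.vwp_eq_integral_of_pos` — Zudilin, *J. Théor. Nombres Bordeaux* **15** (2003), Thm 5 (= eq. (4) of
  [Zudilin2002VWPIntegrals]) at `k = 5`: `J₅(h₁; h₂,…,h₆ | 1+h₀−h₃,…,1+h₀−h₇) = ∏_{j=1}^{6}Γ(1+h₀−h_j−h_{j+1})/(Γ(h₁)Γ(h₇))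
  · F₇(h)`;
* the arithmetic lemma "`F₇(h) ∈ ℚ + ℚζ(3) + ℚζ(5)` for integers `1 ≤ h_j ≤ h₀`, `Σh_j ≤ 3h₀+2`" is now a TREE THEOREM:
  `vwpSeries_seven_odd` (`SorokinCensus/WellPoisedSevenOdd.lean`, from `CressonFischlerRivoal2008.theoreme1_holds`).

DICTIONARY (`S = b 0 + a 1`): `h₀ = S − 1`, `h₁ = a₀`, `h_{j+2} = a j` (`j ≤ 4`), `h₇ = S − b 4`.  On a raw admissible
CONVERGENT point of `L₅` with `a₀ ≥ 1` every hypothesis of both inputs is automatic: Zudilin's (6) is `c_j ≥ 1`;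
`h₁ + h₂ ≤ h₀` is the first convergence inequality `c₁ + a₂ > a₀`; and Zudilin's (5) = the degree condition of CFR
Théorème 1, `Σ_{j=1}^{7} h_j ≤ 3h₀ + 2`, IS the third convergence inequality `c₁ + c₃ + c₅ > a₀` (FAMILY 17c) — so the
residual range of gen 4 (`3h₀ < Σh_j ≤ 3h₀+2`, outside [Zudilin2004] (8.1)) is covered.  The one remaining case
`h₇ = S − b 4 ≤ 0` is settled by the PROVED reversal symmetry: `rev q` is a raw admissible point with
`a₀' = S − b 4 ≤ 0`, whose value is rational (`GenPoint.odd_of_nonpos`), and `J(q) = J(rev q)` (`reversalInvariance_holds`).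

## Contents (all PROVED; axioms standard)
* glue: `sorokinIntegral_congr`, `re_riemannZeta_three/five`, `gamma_rat_of_pos_int`, the dictionary `GenPoint.aN/bN/hZ`;
* **`rawLocusOdd_of_converges : vwp_eq_integral_of_pos → ∀ q, q.Raw → q.OnLgen → q.Admissible → q.Converges →
  1 ≤ q.a₀ → q.Odd`**;
* **`rawLocusOdd_of : ConvergenceCriterion → vwp_eq_integral_of_pos → RawLocusOdd`** (the node as typed carries
  `Integrable`, not `Converges`; Fischler's criterion converts — itself closed modulo the cited fact
  `Fischler2002.integralJ_finite_iff` by `ConvergenceCriterionProof.lean`);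
* `balancedDecomposition_converges` — the proved balanced decomposition with the convergence inequalities of the raw
  pieces exported as well (the moves track them), whence
* **`balancedOddIntegrable_of_vwp : vwp_eq_integral_of_pos → BalancedOddIntegrable`** — BALANCED ⇒ ODD for the whole
  generalized family modulo Zudilin's identity ALONE — and `balancedOdd_of : ConvergenceCriterion →
  vwp_eq_integral_of_pos → BalancedOdd` (the landed v2 node, which lacks the integrability hypothesis).
Supersedes the staged gen-4 files `RawLocusOddWellPoised.lean` / `LiteratureZudilin2004LinearFormsOddZeta.lean` (never
filed): no `RawLocusOddWP`/`RawLocusOddResidual` split and no [Zudilin2004] reading are needed any more.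
-/

noncomputable section

namespace Summit.KontsevichZagierPeriods.Zeta5Search.SorokinCensus

open Literature.NumberTheory.Irrationality Literature.NumberTheory.Irrationality.Zudilin2002
  Literature.NumberTheory.Transcendental MeasureTheory Set Finset

/-! ### Glue -/

/-- `J_k(a₀; a | b)` only reads `a i`, `b i` for `i < k`. -/
theorem sorokinIntegral_congr {k : ℕ} {a₀ : ℝ} {a a' b b' : ℕ → ℝ} (ha : ∀ i < k, a i = a' i)
    (hb : ∀ i < k, b i = b' i) : sorokinIntegral k a₀ a b = sorokinIntegral k a₀ a' b' := by
  have h : sorokinIntegrand k a₀ a b = sorokinIntegrand k a₀ a' b' := by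
    funext x
    unfold sorokinIntegrand
    rw [Finset.prod_congr rfl fun j _ => by rw [ha j j.isLt, hb j j.isLt]]
  unfold sorokinIntegral
  rw [h]

/-- `(riemannZeta 3).re = zetaValue 3`. -/
theorem re_riemannZeta_three : (riemannZeta 3).re = zetaValue 3 := by
  have h := ofReal_zetaValue (k := 3) (by norm_num)
  rw [show ((3 : ℕ) : ℂ) = 3 by norm_num] at h
  rw [← h, Complex.ofReal_re]

/-- `(riemannZeta 5).re = zetaValue 5`. -/
theorem re_riemannZeta_five : (riemannZeta 5).re = zetaValue 5 := by
  have h := ofReal_zetaValue (k := 5) (by norm_num)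
  rw [show ((5 : ℕ) : ℂ) = 5 by norm_num] at h
  rw [← h, Complex.ofReal_re]

/-- `Γ` at a positive integer is a rational number (a factorial). -/
theorem gamma_rat_of_pos_int (z : ℤ) (hz : 1 ≤ z) : ∃ r : ℚ, Real.Gamma (z : ℝ) = r := by
  obtain ⟨n, rfl⟩ : ∃ n : ℕ, z = (n : ℤ) + 1 := ⟨(z - 1).toNat, by omega⟩
  refine ⟨(n.factorial : ℚ), ?_⟩
  push_cast
  rw [Real.Gamma_nat_eq_factorial]

namespace GenPoint

/-- The lower exponents as natural numbers on `ℕ` (junk `0` above index `4`). -/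
@[irreducible] def aN (q : GenPoint) (i : ℕ) : ℕ := if h : i < 5 then (q.a ⟨i, h⟩).toNat else 0

/-- The upper exponents as natural numbers on `ℕ` (junk `0` above index `4`). -/
@[irreducible] def bN (q : GenPoint) (i : ℕ) : ℕ := if h : i < 5 then (q.b ⟨i, h⟩).toNat else 0

/-- `aN` casts back to `a` on nonnegative entries. -/
theorem aN_cast (q : GenPoint) {i : ℕ} (hi : i < 5) (h : 0 ≤ q.a ⟨i, hi⟩) : ((q.aN i : ℕ) : ℤ) = q.a ⟨i, hi⟩ := by
  simp [aN, hi, Int.toNat_of_nonneg h]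

/-- `bN` casts back to `b` on nonnegative entries. -/
theorem bN_cast (q : GenPoint) {i : ℕ} (hi : i < 5) (h : 0 ≤ q.b ⟨i, hi⟩) : ((q.bN i : ℕ) : ℤ) = q.b ⟨i, hi⟩ := by
  simp [bN, hi, Int.toNat_of_nonneg h]

/-- Zudilin's parameters `h = (h₀; h₁, …, h₇)` of a raw point of `L₅` (DICTIONARY of the module docstring), as
natural numbers (junk `0` above index `7`). -/
@[irreducible] def hZ (q : GenPoint) (j : ℕ) : ℕ :=
  if j = 0 then (q.b 0 + q.a 1 - 1).toNat else if j = 1 then q.a₀.toNat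
  else if j = 7 then (q.b 0 + q.a 1 - q.b 4).toNat else if j ≤ 6 then q.aN (j - 2) else 0

/-- `hZ 0 = S - 1`. -/
theorem hZ_zero (q : GenPoint) : q.hZ 0 = (q.b 0 + q.a 1 - 1).toNat := by simp [hZ]
/-- `hZ 1 = a₀`. -/
theorem hZ_one (q : GenPoint) : q.hZ 1 = q.a₀.toNat := by simp [hZ]
/-- `hZ 2 = a 0`. -/
theorem hZ_two (q : GenPoint) : q.hZ 2 = q.aN 0 := by simp [hZ]
/-- `hZ 3 = a 1`. -/
theorem hZ_three (q : GenPoint) : q.hZ 3 = q.aN 1 := by simp [hZ]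
/-- `hZ 4 = a 2`. -/
theorem hZ_four (q : GenPoint) : q.hZ 4 = q.aN 2 := by simp [hZ]
/-- `hZ 5 = a 3`. -/
theorem hZ_five (q : GenPoint) : q.hZ 5 = q.aN 3 := by simp [hZ]
/-- `hZ 6 = a 4`. -/
theorem hZ_six (q : GenPoint) : q.hZ 6 = q.aN 4 := by simp [hZ]
/-- `hZ 7 = S - b 4`. -/
theorem hZ_seven (q : GenPoint) : q.hZ 7 = (q.b 0 + q.a 1 - q.b 4).toNat := by simp [hZ]
/-- `hZ (i+2) = a i` for `i < 5`. -/
theorem hZ_add_two (q : GenPoint) {i : ℕ} (hi : i < 5) : q.hZ (i + 2) = q.aN i := by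
  interval_cases i <;> simp [hZ]

end GenPoint

open GenPoint

set_option maxHeartbeats 1600000 in
/-- **`RawLocusOdd` on convergent points, from Zudilin's identity alone**: a raw admissible CONVERGENT point of `L₅` with
`a₀ ≥ 1` has value in `ℚ + ℚζ(3) + ℚζ(5)`. Case `S > b 4` (`h₇ ≥ 1`): Zudilin's Thm 5 + `vwpSeries_seven_odd`, the
Γ-prefactor being rational; case `S ≤ b 4`: `J(q) = J(rev q)` is rational. -/
theorem rawLocusOdd_of_converges (h4 : vwp_eq_integral_of_pos) :
    ∀ q : GenPoint, q.Raw → q.OnLgen → q.Admissible → q.Converges → 1 ≤ q.a₀ → q.Odd := by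
  intro q hraw hL hadm hconv ha₀
  obtain ⟨he1, he2, he3⟩ := hraw
  have hL' : q.b 1 + q.a 2 = q.b 0 + q.a 1 ∧ q.b 2 + q.a 3 = q.b 0 + q.a 1 ∧ q.b 3 + q.a 4 = q.b 0 + q.a 1 := by
    obtain ⟨h01, h12, h23⟩ := hL
    simp [GenPoint.T, he1, he2, he3] at h01 h12 h23
    refine ⟨by linarith, by linarith, by linarith⟩
  obtain ⟨hS1, hS2, hS3⟩ := hL'
  obtain ⟨ha0l, ha0u⟩ := hadm 0
  obtain ⟨ha1l, ha1u⟩ := hadm 1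
  obtain ⟨ha2l, ha2u⟩ := hadm 2
  obtain ⟨ha3l, ha3u⟩ := hadm 3
  obtain ⟨ha4l, ha4u⟩ := hadm 4
  -- the two convergence inequalities that matter on `L₅` (FAMILY 17c, first and third at `e = 0`)
  have hc1 : q.c 0 + q.a 1 > q.a₀ := hconv.1
  have hc3 : q.c 0 + q.c 2 + q.c 4 > q.a₀ + q.e 2 := hconv.2.2.1
  simp only [GenPoint.c, he2, add_zero] at hc1 hc3
  by_cases hW3 : q.b 4 + 1 ≤ q.b 0 + q.a 1
  swap
  · -- `h₇ ≤ 0`: the reversed point is raw, admissible, with `a₀' = S - b 4 ≤ 0`, hence has a rational value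
    have hrraw : q.rev.Raw := (rev_raw_iff q).mpr hL
    have hradm : q.rev.Admissible := rev_admissible q hadm (by unfold GenPoint.c; omega)
    have hr0 : q.rev.a₀ ≤ 0 := by
      show q.b 3 - q.c 4 ≤ 0
      unfold GenPoint.c; omega
    obtain ⟨c, hc⟩ := GenPoint.odd_of_nonpos q.rev hrraw hradm hr0
    exact ⟨c, by rw [(reversalInvariance_holds q).1]; exact hc⟩
  -- `h₇ ≥ 1`: Zudilin's Theorem 5 applies
  -- the dictionary, as integers
  have eA0 : ((q.aN 0 : ℕ) : ℤ) = q.a 0 := q.aN_cast (i := 0) (by norm_num) (by show (0 : ℤ) ≤ q.a 0; omega)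
  have eA1 : ((q.aN 1 : ℕ) : ℤ) = q.a 1 := q.aN_cast (i := 1) (by norm_num) (by show (0 : ℤ) ≤ q.a 1; omega)
  have eA2 : ((q.aN 2 : ℕ) : ℤ) = q.a 2 := q.aN_cast (i := 2) (by norm_num) (by show (0 : ℤ) ≤ q.a 2; omega)
  have eA3 : ((q.aN 3 : ℕ) : ℤ) = q.a 3 := q.aN_cast (i := 3) (by norm_num) (by show (0 : ℤ) ≤ q.a 3; omega)
  have eA4 : ((q.aN 4 : ℕ) : ℤ) = q.a 4 := q.aN_cast (i := 4) (by norm_num) (by show (0 : ℤ) ≤ q.a 4; omega)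
  have eB0 : ((q.bN 0 : ℕ) : ℤ) = q.b 0 := q.bN_cast (i := 0) (by norm_num) (by show (0 : ℤ) ≤ q.b 0; omega)
  have eB1 : ((q.bN 1 : ℕ) : ℤ) = q.b 1 := q.bN_cast (i := 1) (by norm_num) (by show (0 : ℤ) ≤ q.b 1; omega)
  have eB2 : ((q.bN 2 : ℕ) : ℤ) = q.b 2 := q.bN_cast (i := 2) (by norm_num) (by show (0 : ℤ) ≤ q.b 2; omega)
  have eB3 : ((q.bN 3 : ℕ) : ℤ) = q.b 3 := q.bN_cast (i := 3) (by norm_num) (by show (0 : ℤ) ≤ q.b 3; omega)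
  have eB4 : ((q.bN 4 : ℕ) : ℤ) = q.b 4 := q.bN_cast (i := 4) (by norm_num) (by show (0 : ℤ) ≤ q.b 4; omega)
  have eH0 : ((q.hZ 0 : ℕ) : ℤ) = q.b 0 + q.a 1 - 1 := by rw [hZ_zero]; exact Int.toNat_of_nonneg (by omega)
  have eH1 : ((q.hZ 1 : ℕ) : ℤ) = q.a₀ := by rw [hZ_one]; exact Int.toNat_of_nonneg (by omega)
  have eH2 : ((q.hZ 2 : ℕ) : ℤ) = q.a 0 := by rw [hZ_two]; exact eA0
  have eH3 : ((q.hZ 3 : ℕ) : ℤ) = q.a 1 := by rw [hZ_three]; exact eA1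
  have eH4 : ((q.hZ 4 : ℕ) : ℤ) = q.a 2 := by rw [hZ_four]; exact eA2
  have eH5 : ((q.hZ 5 : ℕ) : ℤ) = q.a 3 := by rw [hZ_five]; exact eA3
  have eH6 : ((q.hZ 6 : ℕ) : ℤ) = q.a 4 := by rw [hZ_six]; exact eA4
  have eH7 : ((q.hZ 7 : ℕ) : ℤ) = q.b 0 + q.a 1 - q.b 4 := by rw [hZ_seven]; exact Int.toNat_of_nonneg (by omega)
  -- integer inequalities behind (5), (6) and positivity
  have i5 : q.hZ 1 + q.hZ 2 + q.hZ 3 + q.hZ 4 + q.hZ 5 + q.hZ 6 + q.hZ 7 ≤ 3 * q.hZ 0 + 2 := by omega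
  have i12 : q.hZ 1 + q.hZ 2 < 1 + q.hZ 0 := by omega
  have i23 : q.hZ 2 + q.hZ 3 < 1 + q.hZ 0 := by omega
  have i34 : q.hZ 3 + q.hZ 4 < 1 + q.hZ 0 := by omega
  have i45 : q.hZ 4 + q.hZ 5 < 1 + q.hZ 0 := by omega
  have i56 : q.hZ 5 + q.hZ 6 < 1 + q.hZ 0 := by omega
  have i67 : q.hZ 6 + q.hZ 7 < 1 + q.hZ 0 := by omega
  have p0 : 0 < q.hZ 0 := by omega
  have p1 : 0 < q.hZ 1 := by omega
  have p2 : 0 < q.hZ 2 := by omega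
  have p3 : 0 < q.hZ 3 := by omega
  have p4 : 0 < q.hZ 4 := by omega
  have p5 : 0 < q.hZ 5 := by omega
  have p6 : 0 < q.hZ 6 := by omega
  have p7 : 0 < q.hZ 7 := by omega
  -- the arithmetic input: `F₇(hZ) ∈ ℚ + ℚζ(3) + ℚζ(5)` (tree theorem `vwpSeries_seven_odd`)
  obtain ⟨c, hc⟩ := vwpSeries_seven_odd q.hZ (by omega)
    (fun j hj => by rw [Finset.mem_Icc] at hj; obtain ⟨hj1, hj2⟩ := hj; interval_cases j <;> omega)
    (by rw [sum_Icc_one_seven]; omega)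
  -- Zudilin's Theorem 5 (k = 5) for the real parameters `hr`
  set hr : ℕ → ℝ := fun j => ((q.hZ j : ℕ) : ℝ) with hr_def
  have cast_lt : ∀ {m n : ℕ}, m < n → ((m : ℕ) : ℝ) < n := fun h => by exact_mod_cast h
  have cast_pos : ∀ {n : ℕ}, 0 < n → (0 : ℝ) < n := fun h => Nat.cast_pos.mpr h
  have cast_le : ∀ {m n : ℕ}, m ≤ n → ((m : ℕ) : ℝ) ≤ n := fun h => by exact_mod_cast h
  have r5 : (2 / (((5 : ℕ) : ℝ) + 1)) * (∑ j ∈ Finset.Icc 1 (5 + 2), hr j) < 1 + hr 0 := by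
    rw [show (5 : ℕ) + 2 = 7 from rfl, sum_Icc_one_seven]
    have := cast_le i5
    simp only [hr_def]; push_cast at this ⊢
    have h6 : (0 : ℝ) < 5 + 1 := by norm_num
    rw [div_mul_eq_mul_div, div_lt_iff₀ h6]
    linarith
  have r6 : ∀ j ∈ Finset.Icc 2 (5 + 1), 0 < hr j ∧ hr j < 1 + hr 0 - hr (j + 1) := by
    intro j hj
    rw [Finset.mem_Icc] at hj
    obtain ⟨hj1, hj2⟩ := hj
    simp only [hr_def]
    interval_cases j <;> (try simp only [Nat.reduceAdd])
    · exact ⟨cast_pos p2, by have := cast_lt i23; push_cast at this; linarith⟩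
    · exact ⟨cast_pos p3, by have := cast_lt i34; push_cast at this; linarith⟩
    · exact ⟨cast_pos p4, by have := cast_lt i45; push_cast at this; linarith⟩
    · exact ⟨cast_pos p5, by have := cast_lt i56; push_cast at this; linarith⟩
    · exact ⟨cast_pos p6, by have := cast_lt i67; push_cast at this; linarith⟩
  have r0 : 0 < hr 0 := by simp only [hr_def]; exact cast_pos p0
  have r1 : 0 < hr 1 := by simp only [hr_def]; exact cast_pos p1
  have r7 : 0 < hr (5 + 2) := by simp only [hr_def, Nat.reduceAdd]; exact cast_pos p7
  have r12 : hr 1 + hr 2 < 1 + hr 0 := by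
    simp only [hr_def]; have := cast_lt i12; push_cast at this; linarith
  have key := h4 5 hr (by norm_num) r5 r6 r0 r1 r7 r12
  -- the Γ-prefactor is rational
  have hG : ∀ j ∈ Finset.Icc 1 (5 + 1), ∃ r : ℚ, Real.Gamma (1 + hr 0 - hr j - hr (j + 1)) = r := by
    intro j hj
    rw [Finset.mem_Icc] at hj
    obtain ⟨hj1, hj2⟩ := hj
    have hle : q.hZ j + q.hZ (j + 1) ≤ q.hZ 0 := by
      interval_cases j <;> (try simp only [Nat.reduceAdd]) <;> omega
    have e : 1 + hr 0 - hr j - hr (j + 1) = (((1 + (q.hZ 0 : ℤ) - q.hZ j - q.hZ (j + 1) : ℤ)) : ℝ) := by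
      simp only [hr_def]; push_cast; ring
    rw [e]
    exact gamma_rat_of_pos_int _ (by omega)
  choose! g hg using hG
  have hP : (∏ j ∈ Finset.Icc 1 (5 + 1), Real.Gamma (1 + hr 0 - hr j - hr (j + 1))) =
      ((∏ j ∈ Finset.Icc 1 (5 + 1), g j : ℚ) : ℝ) := by
    push_cast
    exact Finset.prod_congr rfl hg
  obtain ⟨g1, hg1⟩ : ∃ r : ℚ, Real.Gamma (hr 1) = r := by
    have e : hr 1 = (((q.hZ 1 : ℕ) : ℤ) : ℝ) := by simp only [hr_def]; push_cast; ring
    rw [e]; exact gamma_rat_of_pos_int _ (by omega)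
  obtain ⟨g7, hg7⟩ : ∃ r : ℚ, Real.Gamma (hr (5 + 2)) = r := by
    have e : hr (5 + 2) = (((q.hZ 7 : ℕ) : ℤ) : ℝ) := by simp only [hr_def]; push_cast; ring
    rw [e]; exact gamma_rat_of_pos_int _ (by omega)
  rw [hP, hg1, hg7] at key
  have hF : vwpSeries (5 + 2) hr = c 0 + c 1 * zetaValue 3 + c 2 * zetaValue 5 := by
    rw [show (5 : ℕ) + 2 = 7 from rfl]; exact hc
  rw [hF] at key
  -- `q.J` is the right-hand side of `key`
  have hab : ∀ i < 5, 1 ≤ q.aN i ∧ q.aN i < q.bN i := by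
    intro i hi
    interval_cases i <;> omega
  have hq' : (⟨q.a₀, q.a, q.b, fun _ => 0⟩ : GenPoint) = ofNat (q.hZ 1) q.aN q.bN := by
    simp only [ofNat, GenPoint.mk.injEq]
    refine ⟨eH1.symm, ?_, ?_, trivial⟩
    · funext j
      exact (q.aN_cast j.isLt (by have := (hadm j).1; simp only [Fin.eta]; omega)).symm
    · funext j
      exact (q.bN_cast j.isLt (by have := (hadm j).1; have := (hadm j).2; simp only [Fin.eta]; omega)).symm
  have hint : q.integrand = (ofNat (q.hZ 1) q.aN q.bN).integrand := by
    rw [← hq']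
    funext x
    simp only [integrand, GenPoint.c, he1, he2, he3, neg_zero, zpow_zero, mul_one]
  have hJ1 : q.J = (ofNat (q.hZ 1) q.aN q.bN).J := by unfold J; rw [hint]
  have hJ2 : (ofNat (q.hZ 1) q.aN q.bN).J =
      sorokinIntegral 5 (hr 1) (fun i => hr (i + 2)) (fun i => 1 + hr 0 - hr (i + 3)) := by
    rw [J_ofNat _ _ _ hab]
    unfold J5
    have e1 : ((q.hZ 1 : ℕ) : ℝ) = hr 1 := by simp only [hr_def]
    rw [e1]
    apply sorokinIntegral_congr
    · intro i hi
      simp only [hr_def, q.hZ_add_two hi]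
    · intro i hi
      simp only [hr_def]
      have e : ((q.bN i : ℕ) : ℤ) = 1 + (q.hZ 0 : ℤ) - (q.hZ (i + 3) : ℤ) := by
        interval_cases i <;> simp only [Nat.reduceAdd] <;> omega
      have e' := congrArg (Int.cast : ℤ → ℝ) e
      push_cast at e'
      exact e'
  -- assemble
  refine ⟨![(∏ j ∈ Finset.Icc 1 (5 + 1), g j) / (g1 * g7) * c 0,
    (∏ j ∈ Finset.Icc 1 (5 + 1), g j) / (g1 * g7) * c 1, (∏ j ∈ Finset.Icc 1 (5 + 1), g j) / (g1 * g7) * c 2], ?_⟩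
  simp only [Matrix.cons_val_zero, Matrix.cons_val_one, Matrix.head_cons, Matrix.cons_val_two, Matrix.tail_cons]
  rw [hJ1, hJ2, ← key, re_riemannZeta_three, re_riemannZeta_five]
  push_cast
  ring

/-- **The node `RawLocusOdd`, closed modulo the cited identity and the convergence criterion** (the node carries
`Integrable`; `ConvergenceCriterion` — Fischler's criterion, itself closed modulo the cited fact
`Fischler2002.integralJ_finite_iff` — converts it into the inequalities). -/
theorem rawLocusOdd_of (hC : ConvergenceCriterion) (h4 : vwp_eq_integral_of_pos) : RawLocusOdd :=
  fun q hraw hL hadm hint ha₀ => rawLocusOdd_of_converges h4 q hraw hL hadm ((hC q hadm ha₀).mp hint) ha₀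

/-- **BALANCED DECOMPOSITION with convergence exported** (the moves `P_j(N)`, `σ`, `ψ₁`, `rev` all preserve the eight
convergence inequalities — `shift_converges`, `sigma_converges`, `psi1_converges`, `rev_converges` — and the proved
`locusRep_of_inNgen` records them): every balanced admissible convergent integrable point is an `ℕ`-combination of RAW
admissible CONVERGENT integrable points of `L^gen`. Same proof as `balancedDecompositionIntegrable_of`, one conjunct more. -/
theorem balancedDecomposition_converges :
    ∀ p : GenPoint, p.Admissible → p.Converges → p.Integrable → p.Balanced →
      ∃ (n : ℕ) (m : Fin n → ℕ) (q : Fin n → GenPoint),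
        (∀ t, (q t).Raw ∧ (q t).OnLgen ∧ (q t).Admissible ∧ (q t).Converges ∧ (q t).Integrable) ∧
        p.J = ∑ t, (m t : ℝ) * (q t).J := by
  have hE := eulerInvariance_holds
  have hR := reversalInvariance_holds
  intro p ha hconv hint hbal
  have horbit := (balanced_iff_orbit p ha).mp hbal
  have h1p : p.c 0 + p.a 1 > p.a₀ := hconv.1
  obtain ⟨q, hqN, hqE, hqa, hqc, hqi, hJ⟩ : ∃ q : GenPoint,
      q.InNgen ∧ q.Eneg ∧ q.Admissible ∧ q.Converges ∧ q.Integrable ∧ p.J = q.J := by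
    rcases horbit with ⟨hN, hEn⟩ | ⟨hN, hEn⟩ | ⟨hN, hEn⟩ | ⟨hN, hEn⟩
    · exact ⟨p, hN, hEn, ha, hconv, hint, rfl⟩
    · exact ⟨p.psi1, hN, hEn, psi1_admissible p ha h1p, psi1_converges p ha hconv, (hE p).2.mp hint, (hE p).1⟩
    · exact ⟨p.sigma, hN, hEn, sigma_admissible p ha, sigma_converges p ha hconv, p.integrable_sigma_iff.mp hint,
        p.J_sigma⟩
    · exact ⟨p.sigma.psi1, hN, hEn, psi1_admissible _ (sigma_admissible p ha) (sigma_converges p ha hconv).1,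
        psi1_converges _ (sigma_admissible p ha) (sigma_converges p ha hconv),
        (hE p.sigma).2.mp (p.integrable_sigma_iff.mp hint), p.J_sigma.trans (hE p.sigma).1⟩
  obtain ⟨n, m, r, hr, hqJ⟩ := locusRep_of_inNgen q hqa hqc hqi hqN
  have hrev : ∀ t, (r t).rev.Raw ∧ (r t).rev.InNgen ∧ (r t).rev.Admissible ∧ (r t).rev.Converges ∧
      (r t).rev.Integrable ∧ (r t).J = (r t).rev.J := by
    intro t
    obtain ⟨hL, hA, hC, hI, _, he⟩ := hr t
    have hEn : (r t).Eneg := by simp only [Eneg, he]; exact hqE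
    exact ⟨(rev_raw_iff _).mpr hL, (rev_inNgen_iff _).mpr hEn, rev_admissible _ hA hC.1, rev_converges _ hA hC,
      (hR _).2.mp hI, (hR _).1⟩
  have hfin : ∀ t, ∃ (n' : ℕ) (m' : Fin n' → ℕ) (s : Fin n' → GenPoint),
      (∀ u, (s u).Raw ∧ (s u).OnLgen ∧ (s u).Admissible ∧ (s u).Converges ∧ (s u).Integrable) ∧
      (r t).J = ∑ u, (m' u : ℝ) * (s u).J := by
    intro t
    obtain ⟨hRaw, hN', hA', hC', hI', hJ'⟩ := hrev t
    obtain ⟨n', m', s, hs, hJs⟩ := locusRep_of_inNgen _ hA' hC' hI' hN'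
    refine ⟨n', m', s, fun u => ?_, hJ'.trans hJs⟩
    obtain ⟨hs1, hs2, hs3, hs4, _, hs6⟩ := hs u
    refine ⟨?_, hs1, hs2, hs3, hs4⟩
    simp only [Raw, hs6]
    exact hRaw
  obtain ⟨n', m', s, hs, hv⟩ :=
    combine (P := fun w => w.Raw ∧ w.OnLgen ∧ w.Admissible ∧ w.Converges ∧ w.Integrable) m r hfin
  exact ⟨n', m', s, hs, by rw [hJ, hqJ]; exact hv⟩

/-- **BALANCED ⇒ ODD for the whole generalized family, modulo Zudilin's identity ALONE** (FAMILY 17d(⇐)):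
`vwp_eq_integral_of_pos → BalancedOddIntegrable`. The raw pieces with `a₀ ≤ 0` are rational (`odd_of_nonpos`), those with
`a₀ ≥ 1` are odd by `rawLocusOdd_of_converges`. -/
theorem balancedOddIntegrable_of_vwp (h4 : vwp_eq_integral_of_pos) : BalancedOddIntegrable := by
  intro p hadm hconv hint _ hbal
  obtain ⟨n, m, q, hq, hJ⟩ := balancedDecomposition_converges p hadm hconv hint hbal
  have hodd : ∀ t, (q t).Odd := fun t =>
    (le_or_gt 1 (q t).a₀).elim
      (fun h1 => rawLocusOdd_of_converges h4 (q t) (hq t).1 (hq t).2.1 (hq t).2.2.1 (hq t).2.2.2.1 h1)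
      (fun h1 => GenPoint.odd_of_nonpos (q t) (hq t).1 (hq t).2.2.1 (by omega))
  choose r hr using hodd
  refine ⟨![∑ t, (m t : ℚ) * r t 0, ∑ t, (m t : ℚ) * r t 1, ∑ t, (m t : ℚ) * r t 2], ?_⟩
  rw [hJ]
  simp only [Matrix.cons_val_zero, Matrix.cons_val_one, Matrix.cons_val_two, Matrix.head_cons, Matrix.tail_cons]
  push_cast
  simp only [hr]
  rw [Finset.sum_mul, Finset.sum_mul, ← Finset.sum_add_distrib, ← Finset.sum_add_distrib]
  exact Finset.sum_congr rfl fun t _ => by ring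

/-- The landed v2 node `BalancedOdd` (no integrability hypothesis) modulo the criterion and the identity. -/
theorem balancedOdd_of (hC : ConvergenceCriterion) (h4 : vwp_eq_integral_of_pos) : BalancedOdd :=
  fun p hadm hconv ha₀ hbal => balancedOddIntegrable_of_vwp h4 p hadm hconv ((hC p hadm ha₀).mpr hconv) ha₀ hbal

end Summit.KontsevichZagierPeriods.Zeta5Search.SorokinCensus
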